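import Summits.QuantumFields.BalabanUV.T4Continuum.Support.NE9LinSizeEnd
import Summits.QuantumFields.BalabanUV.T4Continuum.Support.NE9Lemma1Counting
import Summits.QuantumFields.BalabanUV.T4Continuum.Support.NE9LinSizeEndBudget

/-!
# NE9LinSizeEndPiece — E5′-π: the d-currency torus END face of row NE9 AT THE PRINTED (1.23)/(1.33)-PIECE FORM of the history
channel — structure binders S3, the fading SOURCE S5 and the profile N (`τ̄ = (6L)⁴`, `ω = L⁻¹`) DISCHARGED BY NAME from the row
owner's `NE9Lemma1Counting` (cell `pub-balaban`, T4-DAG §2 node U3 / §6 NE9; rung (B)+1 on a FIXED finite T⁴; NE9 formalisation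
crew, unit `b2b-balaban-t4-ne9-formalise-leaf-07` gen 3; companion of `NE9LinSizeEndProj` (E5′-P) — own-initiative junction of
leaf-10-g2's E5′ (p209889) with t4-ne9-p1-g23's piece form (p210644); nothing of either is modified)

HONEST FRAMING (T4-DAG PAGE 1).  Rung (B)+1 = existence and uniqueness of the ε → 0 limit of gauge-invariant observables on a
FIXED finite torus T⁴ — NOT infinite volume, NOT a mass gap, NOT the Clay problem.  NE9 is a cell NEW ESTIMATE, NOT PRINTED and
NOT discharged here.  What stays DISPLAYED: ONE per-piece bound `PieceBound` of the (1.24)×(1.25) shape (PROOF-INTERIOR of [I]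
§§3–5, residual class (R-2) — and, per the owner's located correction O-ne9p1g22-1, a bound modelling the channel `𝒯 ∘ P` fed
marginal-free packages, never the bare curly bracket of a marginal input), the level counts `LevelCounts` ([II] p. 8 numerals,
not verified), the source discipline `SrcScale`, `Factorises` / `LastCouplingLipschitz` (recursion side), and every activity /
geometry / (A″) / (L‴) binder of E5′ VERBATIM.  0 `def`, 0 `sorry`, no END face re-wired; [I]/[II] locators are TYPE locators
(ABSOLUTE RULE); `FlowStep.BetaPertH`, (B), (B^μ) do not occur.  HONEST DEPENDENCY (verbatim): continuum YM on T⁴ ⇐ BetaPertH ∧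
nine spine estimates (0/9 proved); BetaPertH ⇐ (D1) ∧ (D4) ∧ CAP+tail; G-an2-4 gates asym, D1 and NE2/3/4.

WHY.  Skeleton SKELETON-NE9-P1 v1.3.3 §3: row S5 (`hstep` + profile `hτ`/`hω`/`hτbar`) is «the ONLY source of the fading
factor» and was, until the owner's parts 1–2 (`NE9Lemma1Gather`, `NE9Lemma1Counting`), a SUPPORTED READING of [II] Lemma 1 per
creation step.  Part 2 proves, for channels of the printed PIECE FORM `pieceChannel Pc`, `ChannelAdditive` / `ChannelStepSum` on
any class and `ChannelSizeAtStepNN Adm (pieceChannel Pc) κ (weightOf …) (tauOf L (ellPrinted L))` with the GEOMETRIC profile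
`τ k j = (6L)⁴·(L⁻¹)^{k−j}` from `PieceBound` + `LevelCounts`.  THIS FILE plugs that into the d-currency face E5′: the rate's
contraction letter `ω` and channel weight `τ̄` stop being dictionary entries of the census («ω = L⁻¹», «τ̄ = c_τ·78⁴») and become
KERNEL consequences of a FORM: **`ω = L⁻¹`, `τ̄ = (6L)⁴`** (= 78⁴ = 37015056 at print's smallest `L = 13`, i.e. `c_τ = 1`).

WHAT IS PROVED (kernel).
§1 **E5′-π `torus_termSize_ne9_and_fadingMemory_of_linSizeDischargers_pieceForm`**: E5′ at `T := pieceChannel Pc`,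
   `wt := weightOf Pc κ₁ d0 O1 Kp`, `τ := tauOf L (ellPrinted L)`; `hadd`/`hsum`/`hstep`/`hτ`/`hω`/`hτbar`/`hpos` DISCHARGED
   (`channelAdditive_piece`, `channelStepSum_piece`, `channelSizeAtStepNN_piece`, `profile_of_pieceForm`, `ellPrinted_nonneg`);
   conclusion LITERALLY `TermSize E W κ Nsz ∧ NE9 E W κ (prodModuli ℓ fun _ => μ_π) ∧ FadingMemory (ℓ/μ_π) μ_π (…)` with
   **`μ_π = L⁻¹ + 4·lipbar·(a₁·e^{−a″(ν+1)})·(6L)⁴`**; `…_pieceForm_of_dLe` — comparability split as `C.d X ≤ d(cubes X)` + `κ ≤ a″`.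
§2 N2 ON THIS FACE'S LETTERS (BY NAME from N2-ter §C `NE9LinSizeEndBudget` at `ω := L⁻¹`, `τ̄ := (6L)⁴`; pure real arithmetic):
   `fade_piece_iff_log_lt` — for `L > 1` and a positive product, `μ_π < 1 ↔ log(4·lipbar·a₁·(6L)⁴ / (1 − L⁻¹)) < a″(ν+1)` (TYPE
   «κ sufficiently large»); `fade_piece_of_kappa_threshold` (with the face's `κ ≤ a″`); `fade_necessary_piece` — fading REQUIRES
   `8(D+1)·2^{2^ν}·(2^(ν+1+2^ν))²·α4·ε′·(6L)⁴ < 1 − L⁻¹`; `fade_necessary_piece_T4_L13` — on T⁴ at `L = 13`: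
   `72·2^58·37015056·α4·ε′ < 12/13`; `piece_tau_T4_L13` (`(6·13)⁴ = 37015056`), `piece_threshold_const_L13`
   (`4·(6·13)⁴/(1 − 13⁻¹) = 160398576`).
DISGUISE TEST.  Every discharged binder is a one-history statement about a linear channel of ONE run (structure, one-run size,
counting); no second history, no coupling difference — S5 is the fading SOURCE, not NE9 (`T4HistoryLipschitzWitness`,
`NE9MarginalProjectionEnd.not_fading_on_full_class`).  NOT DONE HERE: `PieceBound` for Bałaban's pieces (O-NE9-2 instance, with
O-NE9-1); the owner's part 3 (junction with P2-F2's kernel-mass form) is a different junction and is not touched.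

References (TYPE locators only; nothing printed is a hypothesis): T. Bałaban, CMP **116** (1988) 1–22 [Balaban1988RG2Cluster]
(1.23)–(1.29) pp. 7–8, p. 8 l. 9–10, Lemma 1 (1.33)–(1.36) p. 9, (2.27) p. 18, Lemma 3 (2.38) p. 20, (2.40)–(2.41) p. 21; CMP **109**
(1987) [Balaban1987RG1] (0.23) p. 256, p. 257, (0.28)–(0.29) p. 258, (1.18) p. 263, Thm 3 p. 264, (3.54) p. 280; R. Kotecký,
D. Preiss, CMP **103** (1986) [KoteckyPreiss1986].
-/

noncomputable section

namespace Summit.QuantumFields.BalabanUV.T4Continuum.NE9LinSizeEndPiece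

open scoped BigOperators
open Metric Set MeasureTheory BoundedContinuousFunction
open Literature.Probability.LatticeModels
open Literature.MathematicalPhysics.QuantumFieldTheory
open Literature.MathematicalPhysics.QuantumFieldTheory.Balaban1983to89
open Literature.MathematicalPhysics.QuantumFieldTheory.Balaban1983to89.T4OutputRate
open Literature.MathematicalPhysics.QuantumFieldTheory.Balaban1983to89.T4ActivityLipschitz
open Literature.MathematicalPhysics.QuantumFieldTheory.Balaban1983to89.T4HistoryLipschitzRecursion
open Literature.MathematicalPhysics.QuantumFieldTheory.Balaban1983to89.T4HistoryLipschitzOuter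
open Literature.MathematicalPhysics.QuantumFieldTheory.Balaban1983to89.T4HistoryLipschitzActivity
open Literature.MathematicalPhysics.QuantumFieldTheory.Balaban1983to89.T4HistoryLipschitzEntropy
open Literature.MathematicalPhysics.QuantumFieldTheory.Balaban1983to89.T4HistoryLipschitzCubeGeometry
open Literature.MathematicalPhysics.QuantumFieldTheory.Balaban1983to89.T4HistoryLipschitzActivity (ClusterGeom)
open Literature.MathematicalPhysics.QuantumFieldTheory.Balaban1983to89.T4HistoryLipschitzSegment
open Literature.MathematicalPhysics.QuantumFieldTheory.Balaban1983to89.T4HistoryLipschitzLinearSize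
open Summit.QuantumFields.BalabanUV.T4Continuum.NE9Lemma1Counting
open Summit.QuantumFields.BalabanUV.T4Continuum.NE9LinSizeEnd
open Summit.QuantumFields.BalabanUV.T4Continuum.NE9LinSizeEndBudget

/-! ## §1 E5′-π: the d-currency torus face at the piece form of the channel -/

section Torus

variable {ν N : ℕ} {C : Carriers} {D : ℕ}
variable {Bg : Type} {Sp : Type*} [TopologicalSpace Sp] [MeasurableSpace Sp] [OpensMeasurableSpace Sp] {F : Type*}
  [Fintype F] {Ω : Type*} [MeasurableSpace Ω]

/-- The profile binder of the END faces for the piece form, with nonnegativity: `0 ≤ τ k j ≤ (6L)⁴·(L⁻¹)^{k−j}`. [folklore] -/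
theorem pieceProfile {L : ℝ} (hL : 1 < L) :
    ∀ k j : ℕ, j ≤ k → 0 ≤ tauOf L (ellPrinted L) k j ∧ tauOf L (ellPrinted L) k j ≤ (6 * L) ^ 4 * L⁻¹ ^ (k - j) :=
  fun k j hjk => ⟨mul_nonneg (by positivity) (ellPrinted_nonneg (by linarith) k j), (profile_of_pieceForm hL).1 k j hjk⟩

/-- **E5′-π — E5′ WITH THE HISTORY CHANNEL OF THE PRINTED PIECE FORM (kernel composition BY NAME).**
`NE9LinSizeEnd.torus_termSize_ne9_and_fadingMemory_of_linSizeDischargers` applied at `T := pieceChannel Pc` (the (1.33) sum of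
the (1.23) pieces over «all admissible □₀, Y₀, j and X», p. 7), `wt := weightOf Pc κ₁ d0 O1 Kp` (the (1.29) weight per unit of
E₀), `τ := tauOf L (ellPrinted L)`: the STRUCTURE binders `hadd`/`hsum` (S3) are `channelAdditive_piece` / `channelStepSum_piece`,
the fading SOURCE `hstep` (S5) is `channelSizeAtStepNN_piece` from ONE displayed per-piece bound `PieceBound` ((1.24)×(1.25)
shape) and the level counts `LevelCounts` ((1.26)–(1.28) numerals), and the PROFILE binders `hτ`/`hω`/`hτbar` (N) hold with
**`τ̄ = (6L)⁴`, `ω = L⁻¹`** (`profile_of_pieceForm`; p. 8 l. 9–10 «This yields (6L)⁴L^jη»); `hpos` follows from `L > 1`.  Every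
other E5′ binder VERBATIM (KP clause, (2.27) decay extraction, pin budget, pinned sums (1.26), all in Bałaban's linear size;
ADDITIVE rate condition).  Conclusion: `TermSize` and the root with rate letter **`μ_π = L⁻¹ + 4·lipbar·(a₁·e^{−a″(ν+1)})·(6L)⁴`**.
[cite: Balaban1988RG2Cluster, (1.23)-(1.29) pp.7-8, p.8 l.9-10, (1.33)-(1.36) p.9, (2.27) p.18, Lemma 3 (2.38) p.20, (2.40)-(2.41) p.21; Balaban1987RG1, (0.23) p.256, (0.28)-(0.29) p.258, (1.18) p.263; KoteckyPreiss1986, (1)-(3)] -/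
theorem torus_termSize_ne9_and_fadingMemory_of_linSizeDischargers_pieceForm
    (Γ : CubeChart C (Fin ν → ZMod N) (torusAdj ν N) D) {ι αi βi γi : Type} (Pc : PieceData C Bg ι αi βi γi)
    {E : Functional C Bg} {W : Set (ℕ → ℝ)} {Adm : Set (Bg → C.Dom → ℝ)} {Ψ : ℕ → ℝ → (ι → ℝ) → Bg → C.Dom → ℝ}
    {μ : ℕ → ℝ → Bg → Finset (Fin ν → ZMod N) → Measure Ω} {pre : ℕ → ℝ → Bg → Finset (Fin ν → ZMod N) → Ω → ℂ}
    {c : ℕ → ℝ → Bg → Finset (Fin ν → ZMod N) → Ω → F → ℂ}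
    {pt : ℕ → ℝ → Bg → Finset (Fin ν → ZMod N) → Ω → F → Sp} {β : ℕ → Sp → ℝ}
    {dom : ℕ → Finset (Fin ν → ZMod N) → F → Finset (Fin ν → ZMod N)}
    {lip ε' α4 : ℕ → ℝ} {a₁ a'' κ κ₁ d0 O1 L lipbar ℓ a a' : ℝ} {Kp : ℕ → ι → ℝ} {lam p₀ Nsz : ℕ → ℝ}
    (ρ : ℕ → (ι → ℝ) → (Sp →ᵇ ℂ))
    (h0 : ScaleZeroFree E W) (hAdm : AdmissibleTerms E W Adm) (hres : AdmRestrict Adm)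
    -- the piece form: source discipline, ONE per-piece bound, the level counts, L > 1
    (hL1 : 1 < L) (hsrc : SrcScale Pc) (hPiece : PieceBound Pc κ κ₁ d0 Kp (ellPrinted L))
    (hLev : LevelCounts Pc κ κ₁ O1 L (ellPrinted L)) (hKp : ∀ k y, 0 ≤ Kp k y) (hO1 : 0 ≤ O1)
    -- E5′'s remaining recursion-side binders at `T := pieceChannel Pc`, `wt := weightOf …`, `τ := tauOf L (ellPrinted L)`
    (hfac : Factorises E W (pieceChannel Pc) Ψ) (hlast : LastCouplingLipschitz E W (pieceChannel Pc) Ψ κ lam)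
    (hρ : ∀ (k : ℕ) (Q Q' : ι → ℝ) (M : ℝ), (∀ y, |Q y - Q' y| ≤ weightOf Pc κ₁ d0 O1 Kp k y * M) → ‖ρ k Q - ρ k Q'‖ ≤ M)
    (hΨ : ∀ (k : ℕ) (s : ℝ) (Q Q' : ι → ℝ) (U : Bg) (X : C.Dom),
      Ψ k s Q U X - Ψ k s Q' U X =
        (Γ.geom.newTerm (Γ.geom.avgExpLinearAct μ pre fun k s U γ ω => evalFunctional (c k s U γ ω) (pt k s U γ ω))
            k s U X (ρ k Q) -
          Γ.geom.newTerm (Γ.geom.avgExpLinearAct μ pre fun k s U γ ω => evalFunctional (c k s U γ ω) (pt k s U γ ω))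
            k s U X (ρ k Q')).re)
    (hexpl : ∀ g ∈ W, ∀ (k : ℕ) (Q : ι → ℝ) (U : Bg) (X : C.Dom), C.scale X = k + 1 →
      |Ψ k (g k) Q U X -
          (Γ.geom.newTerm (Γ.geom.avgExpLinearAct μ pre fun k s U γ ω => evalFunctional (c k s U γ ω) (pt k s U γ ω))
            k (g k) U X (ρ k Q)).re| ≤ Real.exp (-(κ * C.d X)) * p₀ k)
    (hbase : ∀ g ∈ W, ∀ (U : Bg) (X : C.Dom), C.scale X = 0 → |E g U X| ≤ Real.exp (-(κ * C.d X)) * Nsz 0)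
    (hNsucc : ∀ j, p₀ j + a₁ * Real.exp (-(a'' * (ν + 1))) ≤ Nsz (j + 1)) (hNnn : ∀ j, 0 ≤ Nsz j)
    (hbox : ∀ (k : ℕ) (Q : ι → ℝ),
      (∀ y, |Q y| ≤ weightOf Pc κ₁ d0 O1 Kp k y * sizeRadius (tauOf L (ellPrinted L)) Nsz k) → ∀ x, ‖ρ k Q x‖ ≤ β k x)
    (hpre : ∀ k s U γ, AEStronglyMeasurable (pre k s U γ) (μ k s U γ))
    (hc : ∀ k s U γ Y, AEStronglyMeasurable (fun ω => c k s U γ ω Y) (μ k s U γ))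
    (hpt : ∀ k s U γ Y, Measurable fun ω => pt k s U γ ω Y) (hlip : ∀ k, 0 < lip k) (hlipb : ∀ k, lip k ≤ lipbar)
    (hint₀ : ∀ k s U γ, Integrable (fun ω => ‖pre k s U γ ω‖ * Real.exp (boxExponent c pt β k s U γ ω)) (μ k s U γ))
    (hmeet : ∀ k s U (γ : Finset (Fin ν → ZMod N)) ω Y, c k s U γ ω Y ≠ 0 → ∃ x ∈ γ, x ∈ dom k γ Y)
    (hα4 : ∀ k, 0 ≤ α4 k) (ha : (2:ℝ) ^ ν * Real.log 2 + Real.log (8 * ν) ≤ a)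
    (hliplb : ∀ k, α4 k * 2 ^ (ν + 1 + 2 ^ ν) ≤ lip k)
    (hlin : ∀ k s U (γ : Finset (Fin ν → ZMod N)) ω Y,
      ‖c k s U γ ω Y‖ ≤ α4 k * Real.exp (-(a * (linSize (dom k γ Y) : ℝ))))
    (hdomconn : ∀ k (γ : Finset (Fin ν → ZMod N)) Y, (dom k γ Y).Nonempty →
      ∃ b ∈ dom k γ Y, Polymer.IsConn (torusAdj ν N) (dom k γ Y) b)
    (hdominj : ∀ k (γ : Finset (Fin ν → ZMod N)), Set.InjOn (dom k γ) {Y | (dom k γ Y).Nonempty})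
    (hXconn : ∀ X, ∃ b, Polymer.IsConn (torusAdj ν N) (Γ.cubes X) b)
    (hcmp : ∀ X, κ * C.d X ≤ a'' * (linSize (Γ.cubes X) : ℝ))
    (hε' : ∀ k, 0 ≤ ε' k)
    (hdecayLin : ∀ g ∈ W, ∀ (k : ℕ) (U : Bg) (X : C.Dom), C.scale X = k + 1 → ∀ γ' ∈ Γ.vol X,
      ∫ ω, ‖pre k (g k) U γ' ω‖ * Real.exp (boxExponent c pt β k (g k) U γ' ω) ∂(μ k (g k) U γ') ≤
        ε' k * Real.exp (-(a' * (linSize γ' : ℝ))))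
    (ha₁ : 0 ≤ a₁) (ha'' : 0 ≤ a'')
    (hrate : (2:ℝ) ^ ν * Real.log 2 + Real.log (8 * ν) ≤ a' - a'' - 2 ^ ν * (a₁ + Real.log 2))
    (hsmall : ∀ k, ((D : ℝ) + 1) * (2 * ε' k) * Real.exp (a'' * (ν + 1) + 2 ^ ν * (a₁ + Real.log 2)) *
      2 ^ (ν + 1 + 2 ^ ν) ≤ a₁)
    (hℓ : 0 ≤ ℓ) (hlam : ∀ k, lam k ≤ ℓ) :
    TermSize E W κ Nsz ∧
      NE9 E W κ (prodModuli ℓ fun _ => L⁻¹ + 4 * lipbar * (a₁ * Real.exp (-(a'' * (ν + 1)))) * (6 * L) ^ 4) ∧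
        FadingMemory (ℓ / (L⁻¹ + 4 * lipbar * (a₁ * Real.exp (-(a'' * (ν + 1)))) * (6 * L) ^ 4))
          (L⁻¹ + 4 * lipbar * (a₁ * Real.exp (-(a'' * (ν + 1)))) * (6 * L) ^ 4)
          (prodModuli ℓ fun _ => L⁻¹ + 4 * lipbar * (a₁ * Real.exp (-(a'' * (ν + 1)))) * (6 * L) ^ 4) := by
  have hL0 : 0 < L := by linarith
  have hlipbar : 0 ≤ lipbar := (hlip 0).le.trans (hlipb 0)
  have hω : 0 ≤ L⁻¹ := inv_nonneg.mpr hL0.le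
  have hτbar : 0 ≤ (6 * L) ^ 4 := by positivity
  have hpos : 0 < L⁻¹ + 4 * lipbar * (a₁ * Real.exp (-(a'' * (ν + 1)))) * (6 * L) ^ 4 := by
    have h1 : 0 < L⁻¹ := inv_pos.mpr hL0
    have h2 : 0 ≤ 4 * lipbar * (a₁ * Real.exp (-(a'' * (ν + 1)))) * (6 * L) ^ 4 := by positivity
    linarith
  exact torus_termSize_ne9_and_fadingMemory_of_linSizeDischargers Γ ρ h0 hAdm hres (channelAdditive_piece Pc Adm)
    (channelStepSum_piece hsrc Adm)
    (channelSizeAtStepNN_piece hsrc hPiece hLev hKp hO1 (fun k j => ellPrinted_nonneg hL0.le k j) Adm) hfac hlast hρ hΨ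
    hexpl hbase hNsucc hNnn hbox hpre hc hpt hlip hlipb hint₀ hmeet hα4 ha hliplb hlin hdomconn hdominj hXconn hcmp hε'
    hdecayLin ha₁ ha'' hrate hsmall hℓ hτbar hω hpos hlam (pieceProfile hL1)

/-- **E5′-π WITH THE RATE DISPLAYED AS `κ ≤ a″`**: §1 with E5′'s comparability split into the [dict] clause `C.d X ≤ d(cubes X)`
([I] p. 257) and the ADDITIVE rate `κ ≤ a″` ((2.29)–(2.30) p. 18 / (2.41) p. 21-type loss).
[cite: Balaban1987RG1, p.257; Balaban1988RG2Cluster, (1.33) p.9, (2.29)-(2.30) p.18, (2.41) p.21] -/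
theorem torus_termSize_ne9_and_fadingMemory_of_linSizeDischargers_pieceForm_of_dLe
    (Γ : CubeChart C (Fin ν → ZMod N) (torusAdj ν N) D) {ι αi βi γi : Type} (Pc : PieceData C Bg ι αi βi γi)
    {E : Functional C Bg} {W : Set (ℕ → ℝ)} {Adm : Set (Bg → C.Dom → ℝ)} {Ψ : ℕ → ℝ → (ι → ℝ) → Bg → C.Dom → ℝ}
    {μ : ℕ → ℝ → Bg → Finset (Fin ν → ZMod N) → Measure Ω} {pre : ℕ → ℝ → Bg → Finset (Fin ν → ZMod N) → Ω → ℂ}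
    {c : ℕ → ℝ → Bg → Finset (Fin ν → ZMod N) → Ω → F → ℂ}
    {pt : ℕ → ℝ → Bg → Finset (Fin ν → ZMod N) → Ω → F → Sp} {β : ℕ → Sp → ℝ}
    {dom : ℕ → Finset (Fin ν → ZMod N) → F → Finset (Fin ν → ZMod N)}
    {lip ε' α4 : ℕ → ℝ} {a₁ a'' κ κ₁ d0 O1 L lipbar ℓ a a' : ℝ} {Kp : ℕ → ι → ℝ} {lam p₀ Nsz : ℕ → ℝ}
    (ρ : ℕ → (ι → ℝ) → (Sp →ᵇ ℂ))
    (h0 : ScaleZeroFree E W) (hAdm : AdmissibleTerms E W Adm) (hres : AdmRestrict Adm)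
    (hL1 : 1 < L) (hsrc : SrcScale Pc) (hPiece : PieceBound Pc κ κ₁ d0 Kp (ellPrinted L))
    (hLev : LevelCounts Pc κ κ₁ O1 L (ellPrinted L)) (hKp : ∀ k y, 0 ≤ Kp k y) (hO1 : 0 ≤ O1)
    (hfac : Factorises E W (pieceChannel Pc) Ψ) (hlast : LastCouplingLipschitz E W (pieceChannel Pc) Ψ κ lam)
    (hρ : ∀ (k : ℕ) (Q Q' : ι → ℝ) (M : ℝ), (∀ y, |Q y - Q' y| ≤ weightOf Pc κ₁ d0 O1 Kp k y * M) → ‖ρ k Q - ρ k Q'‖ ≤ M)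
    (hΨ : ∀ (k : ℕ) (s : ℝ) (Q Q' : ι → ℝ) (U : Bg) (X : C.Dom),
      Ψ k s Q U X - Ψ k s Q' U X =
        (Γ.geom.newTerm (Γ.geom.avgExpLinearAct μ pre fun k s U γ ω => evalFunctional (c k s U γ ω) (pt k s U γ ω))
            k s U X (ρ k Q) -
          Γ.geom.newTerm (Γ.geom.avgExpLinearAct μ pre fun k s U γ ω => evalFunctional (c k s U γ ω) (pt k s U γ ω))
            k s U X (ρ k Q')).re)
    (hexpl : ∀ g ∈ W, ∀ (k : ℕ) (Q : ι → ℝ) (U : Bg) (X : C.Dom), C.scale X = k + 1 →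
      |Ψ k (g k) Q U X -
          (Γ.geom.newTerm (Γ.geom.avgExpLinearAct μ pre fun k s U γ ω => evalFunctional (c k s U γ ω) (pt k s U γ ω))
            k (g k) U X (ρ k Q)).re| ≤ Real.exp (-(κ * C.d X)) * p₀ k)
    (hbase : ∀ g ∈ W, ∀ (U : Bg) (X : C.Dom), C.scale X = 0 → |E g U X| ≤ Real.exp (-(κ * C.d X)) * Nsz 0)
    (hNsucc : ∀ j, p₀ j + a₁ * Real.exp (-(a'' * (ν + 1))) ≤ Nsz (j + 1)) (hNnn : ∀ j, 0 ≤ Nsz j)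
    (hbox : ∀ (k : ℕ) (Q : ι → ℝ),
      (∀ y, |Q y| ≤ weightOf Pc κ₁ d0 O1 Kp k y * sizeRadius (tauOf L (ellPrinted L)) Nsz k) → ∀ x, ‖ρ k Q x‖ ≤ β k x)
    (hpre : ∀ k s U γ, AEStronglyMeasurable (pre k s U γ) (μ k s U γ))
    (hc : ∀ k s U γ Y, AEStronglyMeasurable (fun ω => c k s U γ ω Y) (μ k s U γ))
    (hpt : ∀ k s U γ Y, Measurable fun ω => pt k s U γ ω Y) (hlip : ∀ k, 0 < lip k) (hlipb : ∀ k, lip k ≤ lipbar)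
    (hint₀ : ∀ k s U γ, Integrable (fun ω => ‖pre k s U γ ω‖ * Real.exp (boxExponent c pt β k s U γ ω)) (μ k s U γ))
    (hmeet : ∀ k s U (γ : Finset (Fin ν → ZMod N)) ω Y, c k s U γ ω Y ≠ 0 → ∃ x ∈ γ, x ∈ dom k γ Y)
    (hα4 : ∀ k, 0 ≤ α4 k) (ha : (2:ℝ) ^ ν * Real.log 2 + Real.log (8 * ν) ≤ a)
    (hliplb : ∀ k, α4 k * 2 ^ (ν + 1 + 2 ^ ν) ≤ lip k)
    (hlin : ∀ k s U (γ : Finset (Fin ν → ZMod N)) ω Y,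
      ‖c k s U γ ω Y‖ ≤ α4 k * Real.exp (-(a * (linSize (dom k γ Y) : ℝ))))
    (hdomconn : ∀ k (γ : Finset (Fin ν → ZMod N)) Y, (dom k γ Y).Nonempty →
      ∃ b ∈ dom k γ Y, Polymer.IsConn (torusAdj ν N) (dom k γ Y) b)
    (hdominj : ∀ k (γ : Finset (Fin ν → ZMod N)), Set.InjOn (dom k γ) {Y | (dom k γ Y).Nonempty})
    (hXconn : ∀ X, ∃ b, Polymer.IsConn (torusAdj ν N) (Γ.cubes X) b)
    -- the [dict] clause and the ADDITIVE rate
    (hdle : ∀ X, C.d X ≤ (linSize (Γ.cubes X) : ℝ)) (hκ : 0 ≤ κ) (hκa : κ ≤ a'')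
    (hε' : ∀ k, 0 ≤ ε' k)
    (hdecayLin : ∀ g ∈ W, ∀ (k : ℕ) (U : Bg) (X : C.Dom), C.scale X = k + 1 → ∀ γ' ∈ Γ.vol X,
      ∫ ω, ‖pre k (g k) U γ' ω‖ * Real.exp (boxExponent c pt β k (g k) U γ' ω) ∂(μ k (g k) U γ') ≤
        ε' k * Real.exp (-(a' * (linSize γ' : ℝ))))
    (ha₁ : 0 ≤ a₁)
    (hrate : (2:ℝ) ^ ν * Real.log 2 + Real.log (8 * ν) ≤ a' - a'' - 2 ^ ν * (a₁ + Real.log 2))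
    (hsmall : ∀ k, ((D : ℝ) + 1) * (2 * ε' k) * Real.exp (a'' * (ν + 1) + 2 ^ ν * (a₁ + Real.log 2)) *
      2 ^ (ν + 1 + 2 ^ ν) ≤ a₁)
    (hℓ : 0 ≤ ℓ) (hlam : ∀ k, lam k ≤ ℓ) :
    TermSize E W κ Nsz ∧
      NE9 E W κ (prodModuli ℓ fun _ => L⁻¹ + 4 * lipbar * (a₁ * Real.exp (-(a'' * (ν + 1)))) * (6 * L) ^ 4) ∧
        FadingMemory (ℓ / (L⁻¹ + 4 * lipbar * (a₁ * Real.exp (-(a'' * (ν + 1)))) * (6 * L) ^ 4))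
          (L⁻¹ + 4 * lipbar * (a₁ * Real.exp (-(a'' * (ν + 1)))) * (6 * L) ^ 4)
          (prodModuli ℓ fun _ => L⁻¹ + 4 * lipbar * (a₁ * Real.exp (-(a'' * (ν + 1)))) * (6 * L) ^ 4) :=
  torus_termSize_ne9_and_fadingMemory_of_linSizeDischargers_pieceForm Γ Pc ρ h0 hAdm hres hL1 hsrc hPiece hLev hKp hO1 hfac
    hlast hρ hΨ hexpl hbase hNsucc hNnn hbox hpre hc hpt hlip hlipb hint₀ hmeet hα4 ha hliplb hlin hdomconn hdominj hXconn
    (fun X => (mul_le_mul_of_nonneg_left (hdle X) hκ).trans (mul_le_mul_of_nonneg_right hκa (Nat.cast_nonneg _)))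
    hε' hdecayLin ha₁ (hκ.trans hκa) hrate hsmall hℓ hlam

end Torus

/-! ## §2 Leaf N2 on this face's letters: `ω = L⁻¹`, `τ̄ = (6L)⁴` -/

/-- **FADING ON E5′-π IS A LOWER BOUND ON THE DECAY-WEIGHT RATE** (N2-ter §C `fade_iff_log_lt_E5'` BY NAME at `ω := L⁻¹`,
`τ̄ := (6L)⁴`): for `L > 1` and a positive product, `μ_π < 1 ↔ log(4·lipbar·a₁·(6L)⁴ / (1 − L⁻¹)) < a″(ν+1)` — TYPE
«κ sufficiently large» ([I] Thm 3 p. 264 «κ ≥ κ₀»; [II] p. 18), every letter now either a kernel consequence of the form (`L⁻¹`,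
`(6L)⁴`) or an E5′ binder (`lipbar`, `a₁`, `a″`). [cite: Balaban1987RG1, Thm 3 p.264; Balaban1988RG2Cluster, p.8 l.9-10 and p.18 text] -/
theorem fade_piece_iff_log_lt {ν : ℕ} {L lipbar a₁ a'' : ℝ} (hL : 1 < L) (hlip : 0 < lipbar) (ha₁ : 0 < a₁) :
    L⁻¹ + 4 * lipbar * (a₁ * Real.exp (-(a'' * (ν + 1)))) * (6 * L) ^ 4 < 1 ↔
      Real.log (4 * lipbar * a₁ * (6 * L) ^ 4 / (1 - L⁻¹)) < a'' * (ν + 1) :=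
  fade_iff_log_lt_E5' (by positivity) (inv_lt_one_of_one_lt₀ hL)

/-- **«κ SUFFICIENTLY LARGE» SUFFICES ON E5′-π**: with the face's ADDITIVE rate binder `κ ≤ a″`, the threshold at `κ(ν+1)` gives
`μ_π < 1` (N2-ter §C `rate_antitone_E5'` BY NAME). [cite: Balaban1988RG2Cluster, p.18 text; Balaban1987RG1, Thm 3 p.264] -/
theorem fade_piece_of_kappa_threshold {ν : ℕ} {L lipbar a₁ a'' κ : ℝ} (hL : 1 < L) (hlip : 0 < lipbar) (ha₁ : 0 < a₁)
    (hκa : κ ≤ a'') (hthr : Real.log (4 * lipbar * a₁ * (6 * L) ^ 4 / (1 - L⁻¹)) < κ * (ν + 1)) :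
    L⁻¹ + 4 * lipbar * (a₁ * Real.exp (-(a'' * (ν + 1)))) * (6 * L) ^ 4 < 1 :=
  (rate_antitone_E5' (by positivity) hκa).trans_lt ((fade_piece_iff_log_lt hL hlip ha₁).2 hthr)

/-- **NECESSARY POLYNOMIAL SMALLNESS ON E5′-π** (N2-ter §C `fade_necessary_E5'` BY NAME at `τ̄ := (6L)⁴`): under E5′-π's
`hliplb`/`hlipb`/`hsmall`, `μ_π < 1` REQUIRES `8(D+1)·2^{2^ν}·(2^(ν+1+2^ν))²·α4·ε′·(6L)⁴ < 1 − L⁻¹`. [folklore] -/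
theorem fade_necessary_piece {ν D : ℕ} {a'' a₁ ε' α4 lip lipbar L : ℝ} (hα4 : 0 ≤ α4) (hε' : 0 ≤ ε')
    (ha₁ : 0 ≤ a₁) (hliplb : α4 * 2 ^ (ν + 1 + 2 ^ ν) ≤ lip) (hlipb : lip ≤ lipbar)
    (hsmall : ((D : ℝ) + 1) * (2 * ε') * Real.exp (a'' * (ν + 1) + 2 ^ ν * (a₁ + Real.log 2)) * 2 ^ (ν + 1 + 2 ^ ν) ≤ a₁)
    (hfade : L⁻¹ + 4 * lipbar * (a₁ * Real.exp (-(a'' * (ν + 1)))) * (6 * L) ^ 4 < 1) :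
    8 * ((D : ℝ) + 1) * (2:ℝ) ^ (2 ^ ν) * (2 ^ (ν + 1 + 2 ^ ν)) ^ 2 * α4 * ε' * (6 * L) ^ 4 < 1 - L⁻¹ :=
  fade_necessary_E5' hα4 hε' (by positivity) ha₁ hliplb hlipb hsmall hfade

/-- **T⁴ AT PRINT's SMALLEST `L = 13`** ([I] p. 251 «L > 11», odd): `τ̄ = (6·13)⁴ = 78⁴ = 37015056` — the census letter
«τ̄ = c_τ·78⁴» of `NE9FadingCensus.md` §8 with **c_τ = 1**. [folklore] -/
theorem piece_tau_T4_L13 : ((6:ℝ) * 13) ^ 4 = 37015056 := by norm_num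

/-- The threshold constant at `L = 13`: `4·(6·13)⁴ / (1 − 13⁻¹) = 160398576` (so the threshold of `fade_piece_iff_log_lt` reads
`log(160398576·lipbar·a₁) < a″(ν+1)`). [folklore] -/
theorem piece_threshold_const_L13 : (4:ℝ) * (6 * 13) ^ 4 / (1 - (13:ℝ)⁻¹) = 160398576 := by norm_num

/-- The threshold product reassociated onto the constant: `4·lipbar·a₁·τ̄/(1−ω) = (4τ̄/(1−ω))·lipbar·a₁`. [folklore] -/
theorem threshold_product_eq (lipbar a₁ τ ω : ℝ) :
    4 * lipbar * a₁ * τ / (1 - ω) = (4 * τ / (1 - ω)) * lipbar * a₁ := by ring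

/-- **T⁴, `L = 13`: fading on E5′-π ⟺ `log(160398576·lipbar·a₁) < 5a″`.** [folklore] -/
theorem fade_piece_iff_T4_L13 {lipbar a₁ a'' : ℝ} (hlip : 0 < lipbar) (ha₁ : 0 < a₁) :
    (13:ℝ)⁻¹ + 4 * lipbar * (a₁ * Real.exp (-(a'' * ((4:ℕ) + 1)))) * (6 * 13) ^ 4 < 1 ↔
      Real.log (160398576 * lipbar * a₁) < a'' * 5 := by
  rw [fade_piece_iff_log_lt (ν := 4) (by norm_num : (1:ℝ) < 13) hlip ha₁, threshold_product_eq, piece_threshold_const_L13]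
  norm_num

/-- **T⁴, `L = 13`: the necessary polynomial smallness reads `72·2^58·37015056·α4·ε′ < 12/13`.** [folklore] -/
theorem fade_necessary_piece_T4_L13 {a'' a₁ ε' α4 lip lipbar : ℝ} (hα4 : 0 ≤ α4) (hε' : 0 ≤ ε') (ha₁ : 0 ≤ a₁)
    (hliplb : α4 * 2 ^ ((4:ℕ) + 1 + 2 ^ (4:ℕ)) ≤ lip) (hlipb : lip ≤ lipbar)
    (hsmall : (((8:ℕ) : ℝ) + 1) * (2 * ε') * Real.exp (a'' * ((4:ℕ) + 1) + 2 ^ (4:ℕ) * (a₁ + Real.log 2)) *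
      2 ^ ((4:ℕ) + 1 + 2 ^ (4:ℕ)) ≤ a₁)
    (hfade : (13:ℝ)⁻¹ + 4 * lipbar * (a₁ * Real.exp (-(a'' * ((4:ℕ) + 1)))) * (6 * 13) ^ 4 < 1) :
    72 * 2 ^ 58 * 37015056 * α4 * ε' < 12 / 13 := by
  have h := fade_necessary_piece (ν := 4) (D := 8) hα4 hε' ha₁ hliplb hlipb hsmall hfade
  have e : (8:ℝ) * (((8:ℕ) : ℝ) + 1) * (2:ℝ) ^ (2 ^ (4:ℕ)) * ((2:ℝ) ^ ((4:ℕ) + 1 + 2 ^ (4:ℕ))) ^ 2 * α4 * ε' * (6 * 13) ^ 4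
      = 72 * 2 ^ 58 * 37015056 * α4 * ε' := by norm_num; ring
  have e' : (1:ℝ) - (13:ℝ)⁻¹ = 12 / 13 := by norm_num
  rw [e, e'] at h
  exact h

/-- **WITH THE p. 20 SHAPE `L⁴·α4 ≤ M⁻⁴ ≤ 1`** («(LM)⁴α₄ … bounded by 1»): the necessary smallness is implied by the pure-number
smallness `8(D+1)·2^{2^ν}·(2^(ν+1+2^ν))²·1296·ε′ < 1 − L⁻¹` of the (A″)-decay constant `ε′` alone — `(6L)⁴·α4 = 1296·(L⁴α4) ≤
1296`. [cite: Balaban1988RG2Cluster, p.20 text] -/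
theorem piece_necessary_of_p20 {ν D : ℕ} {α4 ε' L X : ℝ} (hε' : 0 ≤ ε') (hX : 0 ≤ X)
    (hp20 : L ^ 4 * α4 ≤ 1) (h : X * 1296 * ε' < 1 - L⁻¹) (hXdef : X = 8 * ((D : ℝ) + 1) * (2:ℝ) ^ (2 ^ ν) * (2 ^ (ν + 1 + 2 ^ ν)) ^ 2) :
    8 * ((D : ℝ) + 1) * (2:ℝ) ^ (2 ^ ν) * (2 ^ (ν + 1 + 2 ^ ν)) ^ 2 * α4 * ε' * (6 * L) ^ 4 < 1 - L⁻¹ := by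
  rw [← hXdef]
  have e : X * α4 * ε' * (6 * L) ^ 4 = X * 1296 * ε' * (L ^ 4 * α4) := by ring
  rw [e]
  have hc : 0 ≤ X * 1296 * ε' := by positivity
  calc X * 1296 * ε' * (L ^ 4 * α4) ≤ X * 1296 * ε' * 1 := mul_le_mul_of_nonneg_left hp20 hc
    _ = X * 1296 * ε' := mul_one _
    _ < 1 - L⁻¹ := h

end Summit.QuantumFields.BalabanUV.T4Continuum.NE9LinSizeEndPiece

end
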